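import Summits.AtomisticToContinuum.HydrodynamicLimit.Theorems.ScoreResponseDominance
import Summits.AtomisticToContinuum.HydrodynamicLimit.Theorems.RelayRaceLocalityRestartPrincipleOfMeanHL
import HarnessLib

/-!
# Score-response dominance, full form: `ScoreLinearResponse` alone implies the conjunct `HydrodynamicLimit`

Corollaries of the landed node «ScoreResponseDominance» (`…Theorems.ScoreResponseDominance`, lens-1 gen 51 of the
root decomposition cell `decomp-a2c`; landed by hand-2 gen 18) composed with the landed mean closure
`RestartPrinciple.hydrodynamicLimit_iff_meanHydroLimitInBand` (`MeanClosure`, stmt-11929, PROVED), whose module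
`…RelayRaceLocalityRestartPrincipleOfMeanHL` is coherent again (gate KICK of 2026-09-01T01:56Z):

* `hydrodynamicLimit_of_scoreLinearResponse : ScoreLinearResponse → _root_.HydrodynamicLimit` — the rank-2 crux
  X_A (stmt-AtomisticToContinuum-13617) of route `OneSphereInfluence` implies the sub-problem conjunct ON ITS OWN
  (`ResamplingInfluence`, `HardCorePoincare`, `MeanVarianceReduction` not load-bearing);
* `scoreLinearResponse_and_iff` — the ladder made explicit;
* `hydrodynamicLimit_of_meanConvergenceOnHull : [M] → _root_.HydrodynamicLimit` — the piece `[M]` of node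
  «AscoliMeanDoor» is itself ≥ the conjunct.

This is lens-1 g51's `ScoreResponseDominanceFull.lean` MINUS the two theorems already landed in
`…Theorems.ScoreResponseDominance` (referenced by name instead; own namespace to avoid re-declaration). [folklore]
-/

noncomputable section

open Set

namespace Summit.AtomisticToContinuum.HydrodynamicLimit.Theorems.ScoreResponseDominanceFull

open Summit.AtomisticToContinuum.HydrodynamicLimit.Theses
open Summit.AtomisticToContinuum.HydrodynamicLimit.Theses.OneSphereInfluence
open Summit.AtomisticToContinuum.HydrodynamicLimit.Theorems.ScoreResponseDominance

/-- **Score-response dominance.** The rank-2 crux `ScoreLinearResponse` of route `OneSphereInfluence`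
implies the sub-problem conjunct `HydrodynamicLimit` ALONE (mean form `meanHydroLimitInBand_of_scoreLinearResponse`
+ the landed mean closure `RestartPrinciple.hydrodynamicLimit_of_meanHydroLimitInBand`): the route's other `closes`
binders `ResamplingInfluence`, `HardCorePoincare`, `MeanVarianceReduction` are not load-bearing. [folklore] -/
theorem hydrodynamicLimit_of_scoreLinearResponse
    (hS : OneSphereInfluence.ScoreLinearResponse) : _root_.HydrodynamicLimit :=
  RestartPrinciple.hydrodynamicLimit_of_meanHydroLimitInBand (meanHydroLimitInBand_of_scoreLinearResponse hS)

/-- The crux and the conjunct, side by side: `ScoreLinearResponse → HydrodynamicLimit` and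
`HydrodynamicLimit ↔ MeanHydroLimitInBand` (the landed equivalence); recorded to make the ladder explicit. [folklore] -/
theorem scoreLinearResponse_and_iff :
    (OneSphereInfluence.ScoreLinearResponse → _root_.HydrodynamicLimit) ∧
      (_root_.HydrodynamicLimit ↔ ResponseRigidity.MeanHydroLimitInBand) :=
  ⟨hydrodynamicLimit_of_scoreLinearResponse, RestartPrinciple.hydrodynamicLimit_iff_meanHydroLimitInBand⟩

/-- **`[M]` ⇒ the conjunct** (`meanHydroLimitInBand_of_meanConvergenceOnHull` + the mean closure). [folklore] -/
theorem hydrodynamicLimit_of_meanConvergenceOnHull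
    (hM : AscoliMeanDoor.MeanConvergenceOnHull) : _root_.HydrodynamicLimit :=
  RestartPrinciple.hydrodynamicLimit_of_meanHydroLimitInBand (meanHydroLimitInBand_of_meanConvergenceOnHull hM)

end Summit.AtomisticToContinuum.HydrodynamicLimit.Theorems.ScoreResponseDominanceFull

end
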